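import Summits.ABC.IUTFork.Cor312ProvKRamified
import Summits.ABC.IUTFork.Repair.CandInternal2RealStrata
import Literature.IUT.HodgeTheaters.Mu6InitialThetaData
import HarnessLib

/-!
# R-H ROUND 4 (D-0133–0135 OPENINGS-CENSUS), row R4OBJ-MU6 / catalogue RC-419 / K-ODD-5: the μ₆ / `v ∣ 2` DATUM CLASS as a
# CONSTRUCTED CARRIER — the Dupuy–Hilado pilot datum OF a μ₆-initial Θ-datum ([ExpEst] Def. 4.1) over `F` and over `K`, its
# 2-adic bad packet, the 2-adic cells of record exposed at it, and what of [IUTchI] Ex. 3.2 (iv) transfers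

Carrier + bookkeeping file of the abc-iut cell (seat abc-iut-L5-t2 gen 12, the [IUTchI] §3 typer of record; KEY
`wake/KEY-abc-iut-L5-t2-R4OBJ-MU6.md`, abc-iut-rh-lead g5; row author rcat-tst-1 g3, `staging/RCAT/tst-1/KERNEL-OPENINGS-ODD.md` K-ODD-5).
TAKES NO SIDE on [IUTchIII] Cor. 3.12 / [IUTchIV] Thm. 1.10 or on any author (D-0045); nothing here asserts abc proved or refuted; a
constructed carrier is OUR object over OUR typed hypothesis structure, not a claim about print; typed ≠ inhabited ≠ proved; located ≠
adjudicated. NO new Literature `Prop` fact, no `instance`, no notation; inputs consumed BY NAME.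

QUESTION. The R-H / RCAT engines price cells at the `K`-level carrier of record `Cor312Prov.pilotDataOfK D K` (abc-iut-C-cert-3) of
`D : InitialThetaData …` ([IUTchI] Def. 3.1, this lineage); Def. 3.1 (b) «of ODD residue characteristic» (`VbadMod_odd`) empties its 2-adic
bad packet (w5-d054 `ne_two_and_ne_l_of_placeOf_mem_S_pilotDataOfK`, rh-typ-12 `RH.VDividesLStratum.stratum_empty` p457243), so rp-d2's 2-adic
window (`CandInternal2RealStrata`, p451037) is priced only generically. [ExpEst] Def. 4.1 — `Mu6InitialThetaData` (p509159): the SAME fields,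
`VbadMod_odd` REMOVED — admits bad places over `2`. Is its carrier constructible over the typed §3 vocabulary? ANSWER (kernel): YES —
`pilotDataOfF` reads only the parity-free fields `VbadMod(_nonempty)`, `multiplicative_over_VbadMod`, `l_prime`, `five_le_l`:
* §1–§2 `VFbad D₆`, `vFbad_finite/_nonempty`, `one_le_qParamOrd`, `ord_j_neg_of_mem_VFbad` (twins of c312-8's parity-free lemmas),
  **`pilotDataOfMu6F D₆ : PilotData F`**, **`pilotDataOfMu6K D₆ L := (pilotDataOfMu6F D₆).baseChange L`** (C-cert-3's `baseChange`).
* §3 COMPATIBILITY (`rfl`): `pilotDataOfMu6F D.toMu6 = pilotDataOfF D`, `pilotDataOfMu6K D.toMu6 L = pilotDataOfK D L` — the μ₆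
  carrier EXTENDS the carrier of record (same object on the odd class).
* §4 STRATUM at `X₆ := pilotDataOfMu6K D₆ K`: at a bad fibre point over `p` only «`p ≠ l`» survives (Def. 3.1 (c) `l_ne_residueChar`,
  kept by Def. 4.1), so **`p ∣ 2l ↔ p = 2`**: row 12's «v ∣ 2l» stratum IS the 2-adic bad packet of `X₆`, no longer provably empty
  (it IS empty at `D.toMu6`: `ne_two_of_placeOf_mem_S_toMu6`).
* §5 THE 2-ADIC CELLS EXPOSED — p451037 instantiated at `K_w := kOf X₆ 2 x` for ANY local datum `q` with `‖q‖^{2l} = 2^{−H}`: top-label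
  NEG `8l(b_e+2) < (l−3)(l+1)H ⟹ q ∉ q^{l⋇²}·ℐ`, height-form NEG, the EMPTY printed lower edge `κ⁻(2) = 0`, and the SHARP positive
  cells `(J²−1)H < 2l ⟹ ∀ j ≤ J, q ∈ q^{j²}·ℐ` — both signs addressable BY NAME at the carrier's own 2-adic packet.
* §6 WHAT TRANSFERS of [IUTchI] Ex. 3.2 (iv) (side condition `Cor312Prov.TwoMulLDvdOrdq`, C-R16 (b)): `G_K` fixes `E_K[2]`, `E_K[l]`; at
  EVERY bad `w` of `X₆` (2-adic included) `E_K` is multiplicative and **`l ∣ ord_w(q)`** (ATAEC V.6.1 transvection at `w ∤ l`); at `w ∤ 2`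
  also `2l ∣ ord_w(q)`; hence **`TwoMulLDvdOrdq X₆ ↔ (∀ w ∈ S, 2 ∈ w → 2 ∣ ord_w(q))`** and, under that, realising q-ideles EXIST at `X₆`.
RESIDUALS (census, Lean form; neither obstructs the construction): (R1) an INHABITANT `D₆ : Mu6InitialThetaData F K F̄ E l P` with
`∃ w ∈ D₆.VbadMod, residueChar w = 2` ([ExpEst] (P7)/Cor. 5.2 existence, NOT constructed — same status as `InitialThetaData`, [IUTchIV]
Cor. 2.2 (ii)); (R2) `∀ w ∈ X₆.S, 2 ∈ w → 2 ∣ X₆.ordq w` (the factor `2` at `w ∣ 2` is Tate uniformisation at `p = 2`, the named fact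
`TateCurve.uniformization`; the transvection route needs `w ∤ 2`). K-ODD-5's generic NEG prediction thus becomes a statement about a NAMED
carrier, and a theorem about a datum once (R1) is inhabited. [claim: Mochizuki2012 / MochizukiEtAl2022, status: disputed] for every locution.
[cite: Mochizuki2012, IUTchI Def. 3.1 (b),(c) pp. 61–62, Ex. 3.2 (iv) p. 71] [cite: MochizukiEtAl2022, Def. 4.1 pp. 201–202]
[cite: DupuyHilado2025, §3.3, §3.4] [cite: SilvermanATAEC1994, V.6 Prop. 6.1 (p. 410)] [cite: MochizukiAbsTopIII2015, Def 5.4 (iii) p. 126]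
-/

noncomputable section

open Set Function NumberField IsDedekindDomain
open scoped Pointwise Classical

namespace Summit.ABC.IUTFork.Repair.Mu6CarrierAtTwo

open Literature.IUT.HodgeTheaters Literature.IUT.LogVolume Literature.AnabelianGeometry.AbsoluteAnabelian
  Literature.IUT.LogThetaLattice
open Summit.ABC.IUTFork.Thm311 Summit.ABC.IUTFork.Thm311.Real Summit.ABC.IUTFork.Cor312Prov
  Summit.ABC.IUTFork.Repair.CandInternal2RealStrata

variable {F K Fbar : Type} [Field F] [NumberField F] [Field K] [NumberField K] [Algebra F K] [Field Fbar]
  [Algebra F Fbar] [Algebra K Fbar] {E : WeierstrassCurve F} [E.IsElliptic] {l : ℕ} {P : BadPlacePredicates K}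

/-! ## §1. The `F`-level carrier of a μ₆-initial Θ-datum -/

section FLevel

variable (D : Mu6InitialThetaData F K Fbar E l P)

/-- **`𝕍(F)^bad`** of a μ₆-initial Θ-datum: the finite places of `F` over `𝕍^bad_mod` ([ExpEst] Def. 4.1 keeps [IUTchI] Def. 3.1 (b) with
«odd» → «arbitrary») — twin of `InitialThetaData.VFbad`; places over `2` NOT excluded. [claim: MochizukiEtAl2022, status: disputed] -/
@[claim "MochizukiEtAl2022" "disputed"]
def VFbad : Set (FinitePlace F) :=
  {v | Val.restrict (fieldOfModuli E) (Val.non v) ∈ Val.non '' D.VbadMod}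

/-- **`𝕍(F)^bad` is finite**: places over `𝕍^bad_mod` are multiplicative (`multiplicative_over_VbadMod`), hence among the finitely many bad
places (`WeierstrassCurve.finite_badPlaces_holds`). Twin of c312-8's `vFbad_finite`; no parity used. [cite: SilvermanAEC2009, VII.5 Prop. 5.1] -/
theorem vFbad_finite : (VFbad D).Finite := by
  have hbad : (E.badPlaces (𝓞 F)).Finite := WeierstrassCurve.finite_badPlaces_holds (𝓞 F) E
  have hpre : {v : FinitePlace F | v.maximalIdeal ∈ E.badPlaces (𝓞 F)}.Finite :=
    hbad.preimage FinitePlace.maximalIdeal_injective.injOn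
  refine hpre.subset fun v hv => ?_
  show v.maximalIdeal ∈ E.badPlaces (𝓞 F)
  rw [WeierstrassCurve.mem_badPlaces_iff]
  exact (D.multiplicative_over_VbadMod v hv).not_hasGoodReductionAt

/-- **`𝕍(F)^bad ≠ ∅`** (`VbadMod_nonempty` + going up, c312-8's `exists_finitePlace_over`). Twin of `vFbad_nonempty`. [folklore] -/
theorem vFbad_nonempty : (VFbad D).Nonempty := by
  obtain ⟨w, hw⟩ := D.VbadMod_nonempty
  obtain ⟨v, hv⟩ := exists_finitePlace_over (F := F) (E := E) w
  exact ⟨v, by show Val.restrict (fieldOfModuli E) (Val.non v) ∈ Val.non '' D.VbadMod; rw [hv]; exact ⟨w, hw, rfl⟩⟩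

/-- **`ord_v(q_v) ≥ 1` on `𝕍(F)^bad`** (multiplicative ⟹ not good ⟹ `ord_v(Δ_min) ≠ 0`, `ordMinimalDiscriminant_eq_zero_iff_holds`).
Twin of `Cor312Prov.one_le_qParamOrd`. [cite: SilvermanAEC2009, VII.5 Prop. 5.1] -/
theorem one_le_qParamOrd {v : FinitePlace F} (hv : v ∈ VFbad D) : 1 ≤ qParamOrd E v.maximalIdeal := by
  have hmult := D.multiplicative_over_VbadMod v hv
  have hiff := WeierstrassCurve.ordMinimalDiscriminant_eq_zero_iff_holds v.maximalIdeal E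
  have hne : E.ordMinimalDiscriminant v.maximalIdeal ≠ 0 := fun h0 => hmult.not_hasGoodReductionAt (hiff.mp h0)
  unfold qParamOrd
  omega

/-- **`ord_v(j_E) < 0` on `𝕍(F)^bad`** (Tate: `ord_v(j_E) = −ord_v(Δ_min)` at a multiplicative place). Twin of w5-d231's
`ord_j_neg_of_mem_VFbad`. [cite: DupuyHilado2025, §3.3] -/
theorem ord_j_neg_of_mem_VFbad {v : FinitePlace F} (hv : v ∈ VFbad D) : ord F v.maximalIdeal E.j < 0 := by
  have h := E.log_valuation_j_eq_ordMinimalDiscriminant_of_hasMultiplicativeReductionAt v.maximalIdeal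
    (D.multiplicative_over_VbadMod v hv)
  have h1 : 1 ≤ qParamOrd E v.maximalIdeal := one_le_qParamOrd D hv
  unfold qParamOrd at h1
  unfold ord
  rw [h]
  omega

/-- **THE `F`-LEVEL CARRIER OF A μ₆-INITIAL Θ-DATUM**: the Dupuy–Hilado pilot datum `(F, j_E, S := 𝕍(F)^bad, l)` OF `D₆` — the recipe of
w5-d231's `Cor312Prov.pilotDataOfF` on [ExpEst] Def. 4.1 data; bad places over `2` ADMITTED in `S`. [claim: MochizukiEtAl2022, status: disputed] -/
@[claim "MochizukiEtAl2022" "disputed"]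
def pilotDataOfMu6F : PilotData F where
  jE := E.j
  S := (vFbad_finite D).toFinset.image FinitePlace.maximalIdeal
  S_nonempty := by
    obtain ⟨v, hv⟩ := vFbad_nonempty D
    exact ⟨v.maximalIdeal, Finset.mem_image_of_mem _ ((vFbad_finite D).mem_toFinset.mpr hv)⟩
  ord_jE_neg := by
    intro x hx
    obtain ⟨v, hv, rfl⟩ := Finset.mem_image.mp hx
    exact ord_j_neg_of_mem_VFbad D ((vFbad_finite D).mem_toFinset.mp hv)
  l := l
  l_prime := D.l_prime
  five_le_l := D.five_le_l

/-- Its bad set is `𝕍(F)^bad`: a prime of `𝓞_F` lies in `S` iff its finite place lies in `𝕍(F)^bad`. [claim: MochizukiEtAl2022, status: disputed] -/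
theorem mem_pilotDataOfMu6F_S_iff (x : HeightOneSpectrum (𝓞 F)) : x ∈ (pilotDataOfMu6F D).S ↔ FinitePlace.mk x ∈ VFbad D := by
  show x ∈ (vFbad_finite D).toFinset.image FinitePlace.maximalIdeal ↔ _
  rw [Finset.mem_image]
  refine ⟨?_, fun hx => ⟨FinitePlace.mk x, (vFbad_finite D).mem_toFinset.mpr hx, FinitePlace.maximalIdeal_mk x⟩⟩
  rintro ⟨w, hw, hwx⟩
  rw [← hwx, FinitePlace.mk_maximalIdeal]
  exact (vFbad_finite D).mem_toFinset.mp hw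

end FLevel

/-! ## §2. The `K`-level carrier (any finite `L ⊇ F`; intended `L := K = F(E_F[l])`) -/

section KLevel

variable (D : Mu6InitialThetaData F K Fbar E l P) (L : Type) [Field L] [NumberField L] [Algebra F L]

/-- **THE `K`-LEVEL CARRIER OF A μ₆-INITIAL Θ-DATUM**: `pilotDataOfMu6F D₆` base-changed along `F ⊆ L` (C-cert-3's `PilotData.baseChange`)
— the μ₆ twin of `Cor312Prov.pilotDataOfK`; its bad set may contain primes over `2`. [claim: MochizukiEtAl2022, status: disputed] -/
@[claim "MochizukiEtAl2022" "disputed"]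
def pilotDataOfMu6K : PilotData L := (pilotDataOfMu6F D).baseChange L

/-- Its `l` is `D₆`'s `l`. [claim: MochizukiEtAl2022, status: disputed] -/
@[simp] theorem pilotDataOfMu6K_l : (pilotDataOfMu6K D L).l = l := rfl

/-- Its `j`-invariant is `j_E` viewed in `L`. [claim: MochizukiEtAl2022, status: disputed] -/
@[simp] theorem pilotDataOfMu6K_jE : (pilotDataOfMu6K D L).jE = algebraMap F L E.j := rfl

/-- Its bad set: the primes of `L` over `𝕍(F)^bad`. [claim: MochizukiEtAl2022, status: disputed] -/
theorem mem_pilotDataOfMu6K_S_iff (w : HeightOneSpectrum (𝓞 L)) :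
    w ∈ (pilotDataOfMu6K D L).S ↔ FinitePlace.mk (finBelow F L w) ∈ VFbad D := by
  unfold pilotDataOfMu6K
  rw [mem_baseChange_S_iff, mem_pilotDataOfMu6F_S_iff]

omit [NumberField L] in
/-- Plumbing: `w` lies over the place `FinitePlace.mk (w ∩ F)` of `F`. [folklore] -/
theorem liesOver_mk_finBelow (w : HeightOneSpectrum (𝓞 L)) :
    w.asIdeal.LiesOver (FinitePlace.mk (finBelow F L w)).maximalIdeal.asIdeal := by
  rw [FinitePlace.maximalIdeal_mk]
  exact liesOver_finBelow F L w

end KLevel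

/-! ## §3. Compatibility: the μ₆ carrier EXTENDS the carrier of record (all `rfl`) -/

section Compatibility

variable (L : Type) [Field L] [NumberField L] [Algebra F L]

/-- **On the odd class the μ₆ carrier IS the carrier of record**: `pilotDataOfMu6F D.toMu6 = pilotDataOfF D`. [claim: MochizukiEtAl2022, status: disputed] -/
theorem pilotDataOfMu6F_toMu6 (D : InitialThetaData F K Fbar E l P) : pilotDataOfMu6F D.toMu6 = pilotDataOfF D := rfl

/-- … and over every `L ⊇ F`: `pilotDataOfMu6K D.toMu6 L = pilotDataOfK D L`. [claim: MochizukiEtAl2022, status: disputed] -/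
theorem pilotDataOfMu6K_toMu6 (D : InitialThetaData F K Fbar E l P) : pilotDataOfMu6K D.toMu6 L = pilotDataOfK D L := rfl

end Compatibility

/-! ## §4. The stratum: at the μ₆ carrier «`v ∣ 2l`» IS the 2-adic bad packet -/

section Stratum

variable (D : Mu6InitialThetaData F K Fbar E l P)

/-- **`l ∉ w` at every place `w` of `K` over `𝕍(F)^bad`** ([IUTchI] Def. 3.1 (c) «`l` prime to the elements of `𝕍^bad_mod`», KEPT by
[ExpEst] Def. 4.1: `l_ne_residueChar`) — the `l`-half of w5-d158's `two_not_mem_and_l_not_mem_of_mem_VFbad`; the `2`-half is GONE with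
`VbadMod_odd`. [cite: Mochizuki2012, IUTchI Def. 3.1 (c) p. 62] [cite: MochizukiEtAl2022, Def. 4.1 p. 201] -/
theorem l_not_mem_of_mem_VFbad {x : FinitePlace F} (hx : x ∈ VFbad D) {vK : HeightOneSpectrum (𝓞 K)}
    [hover : vK.asIdeal.LiesOver x.maximalIdeal.asIdeal] : (l : 𝓞 K) ∉ vK.asIdeal := by
  obtain ⟨w, hw, hwx⟩ := hx
  set Pm : HeightOneSpectrum (𝓞 (fieldOfModuli E)) := x.maximalIdeal.under (𝓞 (fieldOfModuli E)) with hPm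
  have hwx' : w = FinitePlace.mk Pm := Sum.inr_injective (show Val.non w = Val.non (FinitePlace.mk Pm) from hwx)
  have hnel : ringChar (𝓞 (fieldOfModuli E) ⧸ Pm.asIdeal) ≠ l := by
    have h := D.l_ne_residueChar w hw
    rwa [hwx', Literature.IUT.HodgeTheaters.residueChar, NumberField.FinitePlace.maximalIdeal_mk] at h
  haveI : Nontrivial (𝓞 (fieldOfModuli E) ⧸ Pm.asIdeal) := Ideal.Quotient.nontrivial_iff.mpr Pm.isPrime.ne_top
  have hne1 : ringChar (𝓞 (fieldOfModuli E) ⧸ Pm.asIdeal) ≠ 1 := by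
    intro h1
    have h := (ringChar.spec (𝓞 (fieldOfModuli E) ⧸ Pm.asIdeal) 1).mpr (by rw [h1])
    simp only [Nat.cast_one, one_ne_zero] at h
  intro hl
  -- `l ∈ v̲` descends to the place `P_m` of `F_mod` below `x`, where the (prime) characteristic divides it
  have hdesc : (l : 𝓞 (fieldOfModuli E)) ∈ Pm.asIdeal := by
    change (l : 𝓞 (fieldOfModuli E)) ∈ Ideal.comap (algebraMap (𝓞 (fieldOfModuli E)) (𝓞 F)) x.maximalIdeal.asIdeal
    rw [Ideal.mem_comap, map_natCast, hover.over, Ideal.under_def, Ideal.mem_comap, map_natCast]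
    exact hl
  have hd : ringChar (𝓞 (fieldOfModuli E) ⧸ Pm.asIdeal) ∣ l := by
    rw [← ringChar.spec, ← map_natCast (Ideal.Quotient.mk Pm.asIdeal), Ideal.Quotient.eq_zero_iff_mem]
    exact hdesc
  rcases (Nat.dvd_prime D.l_prime).mp hd with h | h
  · exact hne1 h
  · exact hnel h

/-- **At a bad fibre point of the μ₆ carrier the residue characteristic is `≠ l`** — the ONLY survivor of w5-d054's
`ne_two_and_ne_l_of_placeOf_mem_S_pilotDataOfK` once «odd» → «arbitrary». [cite: MochizukiEtAl2022, Def. 4.1 p. 201] -/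
theorem ne_l_of_placeOf_mem_S (pp : Nat.Primes) (x : (thetaIndex (pilotDataOfMu6K D K)).Fibre (.inr pp))
    (hx : haveI : Fact (pp : ℕ).Prime := ⟨pp.2⟩; placeOf (pilotDataOfMu6K D K) pp.1 x ∈ (pilotDataOfMu6K D K).S) :
    (pp : ℕ) ≠ l := by
  haveI : Fact (pp : ℕ).Prime := ⟨pp.2⟩
  set w := placeOf (pilotDataOfMu6K D K) pp.1 x with hwdef
  haveI := liesOver_mk_finBelow (F := F) K w
  have h := l_not_mem_of_mem_VFbad D ((mem_pilotDataOfMu6K_S_iff D K w).mp hx) (vK := w)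
  have hp : ((pp : ℕ) : 𝓞 K) ∈ w.asIdeal := natCast_mem_placeOf (pilotDataOfMu6K D K) pp.1 x
  intro hl
  rw [hl] at hp
  exact h hp

/-- **THE «`v ∣ 2l`» STRATUM OF THE μ₆ CARRIER IS ITS 2-ADIC BAD PACKET**: at a bad fibre point over `p`, `p ∣ 2l ↔ p = 2` (R-H round 1
row 12 / `RH.VDividesLStratum` had EMPTY scope at the carrier of record). [cite: MochizukiEtAl2022, Def. 4.1 p. 201] -/
theorem dvd_two_mul_l_iff_eq_two_of_placeOf_mem_S (pp : Nat.Primes) (x : (thetaIndex (pilotDataOfMu6K D K)).Fibre (.inr pp))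
    (hx : haveI : Fact (pp : ℕ).Prime := ⟨pp.2⟩; placeOf (pilotDataOfMu6K D K) pp.1 x ∈ (pilotDataOfMu6K D K).S) :
    (pp : ℕ) ∣ 2 * l ↔ (pp : ℕ) = 2 := by
  have hnel := ne_l_of_placeOf_mem_S D pp x hx
  refine ⟨fun h => ?_, fun h => by rw [h]; exact Dvd.intro _ rfl⟩
  rcases (Nat.Prime.dvd_mul pp.2).1 h with h2 | h2
  · exact (Nat.prime_dvd_prime_iff_eq pp.2 Nat.prime_two).1 h2
  · exact (hnel ((Nat.prime_dvd_prime_iff_eq pp.2 D.l_prime).1 h2)).elim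

/-- **… whereas the carrier of an ODD datum has no bad fibre point over `2`** (§3 + w5-d054): the 2-adic cells of §5 are non-vacuous ONLY at
μ₆-data with a bad place over `2` — residual (R1). [cite: Mochizuki2012, IUTchI Def. 3.1 (b) p. 61] -/
theorem ne_two_of_placeOf_mem_S_toMu6 (D₁ : InitialThetaData F K Fbar E l P) (pp : Nat.Primes)
    (x : (thetaIndex (pilotDataOfMu6K D₁.toMu6 K)).Fibre (.inr pp))
    (hx : haveI : Fact (pp : ℕ).Prime := ⟨pp.2⟩; placeOf (pilotDataOfMu6K D₁.toMu6 K) pp.1 x ∈ (pilotDataOfMu6K D₁.toMu6 K).S) :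
    (pp : ℕ) ≠ 2 :=
  (ne_two_and_ne_l_of_placeOf_mem_S_pilotDataOfK D₁ pp x hx).1

end Stratum

/-! ## §5. The 2-adic cells of record at the carrier's own 2-adic packet (p451037 instantiated at `kOf X₆ 2 x`) -/

section TwoAdicCells

variable (D : Mu6InitialThetaData F K Fbar E l P) (x : (thetaIndex (pilotDataOfMu6K D K)).Fibre (.inr (ratPrime 2)))

/-- **2-ADIC TOP-LABEL NEGATIVE CELL at the μ₆ carrier** (rp-d2's `not_mem_topLabel_of_large_l` at `p = 2`, `c = 2`, `K_w := kOf X₆ 2 x`): for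
every `q ∈ K_w` with `‖q‖^{2l} = 2^{−H}` (e.g. a realising q-idele component, `H = ord_w(q_E)/e_w`), `8l·(b_{e_w} + 2) < (l−3)(l+1)·H ⟹
q ∉ q^{l⋇²}·ℐ_{K_w}` — K-ODD-5's «NEG at the top label», addressed to a NAMED carrier. [cite: MochizukiAbsTopIII2015, Def 5.4 (iii) p. 126] -/
theorem twoAdic_not_mem_topLabel_of_large_l {q : kOf (pilotDataOfMu6K D K) 2 x} {H : ℝ}
    (hqN : ‖q‖ ^ (2 * l) = ((2 : ℕ) : ℝ) ^ (-H))
    (hlt : 8 * (l : ℝ) * (logRadiusB 2 (absRamificationIdx 2 (kOf (pilotDataOfMu6K D K) 2 x)) + 2) < ((l : ℝ) - 3) * ((l : ℝ) + 1) * H) :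
    q ∉ q ^ ((pilotDataOfMu6K D K).lstar ^ 2) • logShell (PadicLogOnUnits.ofUnitLog 2 (kOf (pilotDataOfMu6K D K) 2 x)) := by
  have hl : l = 2 * (pilotDataOfMu6K D K).lstar + 1 := (pilotDataOfMu6K D K).l_eq
  refine not_mem_topLabel_of_large_l 2 (kOf (pilotDataOfMu6K D K) 2 x) (pilotDataOfMu6K D K).lstar (by rw [← hl]; exact hqN) ?_
  rw [pstarExp_two, show ((2 * (pilotDataOfMu6K D K).lstar + 1 : ℕ) : ℝ) = (l : ℝ) by exact_mod_cast hl.symm]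
  exact hlt

/-- **2-ADIC NEGATIVE CELL, height form** (`not_mem_of_lt_two`): `2 + b_{e_w} < (n−1)·h ⟹ q ∉ qⁿ·ℐ_{K_w}`.
[cite: MochizukiAbsTopIII2015, Def 5.4 (iii) p. 126] -/
theorem twoAdic_not_mem_of_lt {q : kOf (pilotDataOfMu6K D K) 2 x} {h : ℝ} (hqh : ‖q‖ = ((2 : ℕ) : ℝ) ^ (-h)) {n : ℕ}
    (hlt : 2 + logRadiusB 2 (absRamificationIdx 2 (kOf (pilotDataOfMu6K D K) 2 x)) < ((n : ℝ) - 1) * h) :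
    q ∉ q ^ n • logShell (PadicLogOnUnits.ofUnitLog 2 (kOf (pilotDataOfMu6K D K) 2 x)) :=
  not_mem_of_lt_two (kOf (pilotDataOfMu6K D K) 2 x) hqh hlt

/-- **THE PRINTED LOWER EDGE IS EMPTY over `2`** (`κ⁻(2) = c − a_e = 0`, `lowerEdge_two`): [IUTchIV] Prop. 1.2 (i)'s `a_e` certifies no positive
cell at the 2-adic packet of the μ₆ carrier beyond `𝒪 ⊆ ℐ` — K-ODD-5's «2-adic POS door never opens», at the carrier. [claim: Mochizuki2012, status: disputed] -/
theorem twoAdic_lowerEdge_eq_zero :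
    ((if (2 : ℕ) = 2 then 2 else 1 : ℕ) : ℝ) - logRadiusA 2 (absRamificationIdx 2 (kOf (pilotDataOfMu6K D K) 2 x)) = 0 :=
  lowerEdge_two _

/-- **… BUT THE SHARP POSITIVE CELLS over `2` ARE NON-EMPTY** (p451037 §6 `allLabels_mem_of_lt_sharp`, `c − 1/(p−1) = 1` at `p = 2`): `q ≠ 0`,
`‖q‖^{2l} = 2^{−H}`, `0 ≤ H`, `(J²−1)·H < 2l ⟹ ∀ j ≤ J, q ∈ q^{j²}·ℐ_{K_w}` — both signs addressable BY NAME. [cite: MochizukiAbsTopIII2015, Def 5.4 (iii) p. 126] -/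
theorem twoAdic_allLabels_mem_of_lt_sharp {q : kOf (pilotDataOfMu6K D K) 2 x} (hq : q ≠ 0) {H : ℝ} (hH : 0 ≤ H)
    (hqN : ‖q‖ ^ (2 * l) = ((2 : ℕ) : ℝ) ^ (-H)) {J : ℕ} (hlt : (((J ^ 2 : ℕ) : ℝ) - 1) * H < ((2 * l : ℕ) : ℝ)) :
    ∀ j ≤ J, q ∈ q ^ (j ^ 2) • logShell (PadicLogOnUnits.ofUnitLog 2 (kOf (pilotDataOfMu6K D K) 2 x)) := by
  refine allLabels_mem_of_lt_sharp 2 (kOf (pilotDataOfMu6K D K) 2 x) hq (l := l) (by have := D.five_le_l; omega) hH hqN ?_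
  rw [show (((if (2 : ℕ) = 2 then 2 else 1 : ℕ) : ℝ) - 1 / (((2 : ℕ) : ℝ) - 1)) = 1 by rw [pstarExp_two]; norm_num, mul_one]
  exact hlt

end TwoAdicCells

/-! ## §6. What transfers of [IUTchI] Ex. 3.2 (iv): `l ∣ ord_w(q)` on all of `S`; the side condition of record reduces to its 2-adic part -/

section SideCondition

/-- **`G_K` fixes `E_K[l](K̄)` pointwise** for a μ₆-datum (Def. 3.1 (c) `range_K_iff`, kept by Def. 4.1; w5-d158's abstract bridge BY NAME).
[cite: Mochizuki2012, IUTchI Def. 3.1 (c) p. 62] -/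
theorem forall_smul_geomTorsion_baseChange_l (D : Mu6InitialThetaData F K Fbar E l P) (τ : Field.absoluteGaloisGroup K)
    (Q : WeierstrassCurve.geomTorsion (E.baseChange K) (l : ℤ)) : τ • Q = Q := by
  haveI := D.isAlgClosure; haveI := D.isScalarTower
  exact forall_smul_geomTorsion_baseChange_eq_of_range_K_iff E D.range_K_iff τ Q

/-- **`G_K` fixes `E_K[2](K̄)` pointwise** for a μ₆-datum (Def. 4.1 keeps «the `2·3`-torsion points of `E_F` are rational over `F`»).
[cite: Mochizuki2012, IUTchI Def. 3.1 (b) p. 62] -/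
theorem forall_smul_geomTorsion_baseChange_two (D : Mu6InitialThetaData F K Fbar E l P) (τ : Field.absoluteGaloisGroup K)
    (Q : WeierstrassCurve.geomTorsion (E.baseChange K) (2 : ℤ)) : τ • Q = Q := by
  haveI := D.isAlgClosure; haveI := D.isScalarTower
  refine forall_smul_geomTorsion_baseChange_eq_of_torsion_rational (Fbar := Fbar) E (fun R hR => ?_) τ Q
  exact D.torsion_six_rational R (by rw [show (6 : ℤ) = 3 * 2 by norm_num, mul_smul, hR, smul_zero])

/-- **`E_K` is multiplicative at every place of `K` over `𝕍(F)^bad` — places over `2` INCLUDED** (semistability from the `l`-torsion, `w ∤ l`).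
[cite: SilvermanAEC2009, VII.5 Prop. 5.1 and VII.6 Thm. 6.1] -/
theorem hasMultiplicativeReductionAt_baseChange (D : Mu6InitialThetaData F K Fbar E l P) {x : FinitePlace F} (hx : x ∈ VFbad D)
    (vK : HeightOneSpectrum (𝓞 K)) [vK.asIdeal.LiesOver x.maximalIdeal.asIdeal] : (E.baseChange K).HasMultiplicativeReductionAt vK :=
  E.hasMultiplicativeReductionAt_baseChange_of_forall_smul_geomTorsion_eq (D.multiplicative_over_VbadMod x hx) D.l_prime
    (by have := D.five_le_l; omega) (l_not_mem_of_mem_VFbad D hx) (forall_smul_geomTorsion_baseChange_l D)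

/-- **`l ∣ ord_w(Δ_min(E_K))` at EVERY place of `K` over `𝕍(F)^bad` — `w ∣ 2` included** (ATAEC V.6.1 transvection at `w ∤ l`): the `l`-part of
[IUTchI] Ex. 3.2 (iv) survives «odd» → «arbitrary». [cite: SilvermanATAEC1994, V.6 Prop. 6.1 (p. 410)] [cite: Mochizuki2012, IUTchI Ex. 3.2 (iv) p. 71] -/
theorem l_dvd_ordMinimalDiscriminant_baseChange (D : Mu6InitialThetaData F K Fbar E l P) {x : FinitePlace F} (hx : x ∈ VFbad D)
    (vK : HeightOneSpectrum (𝓞 K)) [vK.asIdeal.LiesOver x.maximalIdeal.asIdeal] : l ∣ (E.baseChange K).ordMinimalDiscriminant vK := by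
  haveI : (E.baseChange K).IsElliptic := by unfold WeierstrassCurve.baseChange; infer_instance
  exact (E.baseChange K).dvd_ordMinimalDiscriminant_of_forall_smul_geomTorsion_eq (hasMultiplicativeReductionAt_baseChange D hx vK)
    D.l_prime (l_not_mem_of_mem_VFbad D hx) (forall_smul_geomTorsion_baseChange_l D)

/-- **At `w ∤ 2` the full `2l ∣ ord_w(Δ_min(E_K))` holds**, as for initial Θ-data (w5-d158's route, its `h2` binder now a HYPOTHESIS instead of
`VbadMod_odd`). [cite: SilvermanATAEC1994, V.6 Prop. 6.1 (p. 410)] -/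
theorem two_mul_l_dvd_ordMinimalDiscriminant_baseChange_of_two_not_mem (D : Mu6InitialThetaData F K Fbar E l P) {x : FinitePlace F}
    (hx : x ∈ VFbad D) (vK : HeightOneSpectrum (𝓞 K)) [vK.asIdeal.LiesOver x.maximalIdeal.asIdeal] (h2 : (2 : 𝓞 K) ∉ vK.asIdeal) :
    2 * l ∣ (E.baseChange K).ordMinimalDiscriminant vK :=
  E.two_mul_dvd_ordMinimalDiscriminant_baseChange_of_forall_smul_geomTorsion_eq (D.multiplicative_over_VbadMod x hx) D.l_prime
    (by have := D.five_le_l; omega) h2 (l_not_mem_of_mem_VFbad D hx) (forall_smul_geomTorsion_baseChange_two D)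
    (forall_smul_geomTorsion_baseChange_l D)

/-- **`ord_w(q) = ord_w(Δ_min(E_K))` on the bad set of the μ₆ carrier** (Tate at the multiplicative place: `ordq w := −ord_w(j_E)`).
[cite: DupuyHilado2025, §3.3] [cite: SilvermanAEC2009, VII.5 Prop. 5.1] -/
theorem ordq_eq_ordMinimalDiscriminant (D : Mu6InitialThetaData F K Fbar E l P) {w : HeightOneSpectrum (𝓞 K)}
    (hw : w ∈ (pilotDataOfMu6K D K).S) : (pilotDataOfMu6K D K).ordq w = ((E.baseChange K).ordMinimalDiscriminant w : ℤ) := by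
  haveI := liesOver_mk_finBelow (F := F) K w
  haveI : (E.baseChange K).IsElliptic := by unfold WeierstrassCurve.baseChange; infer_instance
  have hlog := (E.baseChange K).log_valuation_j_eq_ordMinimalDiscriminant_of_hasMultiplicativeReductionAt w
    (hasMultiplicativeReductionAt_baseChange D ((mem_pilotDataOfMu6K_S_iff D K w).mp hw) w)
  have hj : (E.baseChange K).j = algebraMap F K E.j := E.map_j (algebraMap F K)
  unfold PilotData.ordq ord
  rw [pilotDataOfMu6K_jE, ← hj, neg_neg, hlog]

/-- **`l ∣ ord_w(q)` at EVERY bad place of the μ₆ carrier** (2-adic ones included). [cite: Mochizuki2012, IUTchI Ex. 3.2 (iv) p. 71] -/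
theorem l_dvd_ordq (D : Mu6InitialThetaData F K Fbar E l P) {w : HeightOneSpectrum (𝓞 K)} (hw : w ∈ (pilotDataOfMu6K D K).S) :
    (l : ℤ) ∣ (pilotDataOfMu6K D K).ordq w := by
  haveI := liesOver_mk_finBelow (F := F) K w
  rw [ordq_eq_ordMinimalDiscriminant D hw]
  exact_mod_cast l_dvd_ordMinimalDiscriminant_baseChange D ((mem_pilotDataOfMu6K_S_iff D K w).mp hw) w

/-- **`2l ∣ ord_w(q)` at every bad place `w ∤ 2` of the μ₆ carrier** — its odd part behaves like the carrier of record (C-cert-3's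
`twoMulLDvdOrdq_pilotDataOfK`). [cite: Mochizuki2012, IUTchI Ex. 3.2 (iv) p. 71] -/
theorem two_mul_l_dvd_ordq_of_two_not_mem (D : Mu6InitialThetaData F K Fbar E l P) {w : HeightOneSpectrum (𝓞 K)}
    (hw : w ∈ (pilotDataOfMu6K D K).S) (h2 : (2 : 𝓞 K) ∉ w.asIdeal) : (2 * (l : ℤ)) ∣ (pilotDataOfMu6K D K).ordq w := by
  haveI := liesOver_mk_finBelow (F := F) K w
  rw [ordq_eq_ordMinimalDiscriminant D hw]
  exact_mod_cast two_mul_l_dvd_ordMinimalDiscriminant_baseChange_of_two_not_mem D ((mem_pilotDataOfMu6K_S_iff D K w).mp hw) w h2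

/-- **THE SIDE CONDITION OF RECORD REDUCES EXACTLY TO ITS 2-ADIC PART**: `TwoMulLDvdOrdq X₆ ↔ (∀ w ∈ S, 2 ∈ w → 2 ∣ ord_w(q))` — «`ord_w(q)`
EVEN at the bad places over `2»` = residual (R2) (the factor `2` at `w ∣ 2` is Tate uniformisation at `p = 2`). [cite: Mochizuki2012, IUTchI Ex. 3.2 (iv) p. 71] -/
theorem twoMulLDvdOrdq_iff_even_at_two (D : Mu6InitialThetaData F K Fbar E l P) :
    TwoMulLDvdOrdq (pilotDataOfMu6K D K) ↔
      ∀ w ∈ (pilotDataOfMu6K D K).S, (2 : 𝓞 K) ∈ w.asIdeal → (2 : ℤ) ∣ (pilotDataOfMu6K D K).ordq w := by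
  refine ⟨fun h w hw _ => (Dvd.intro _ rfl : (2 : ℤ) ∣ 2 * (l : ℤ)).trans (by simpa using h w hw), fun h w hw => ?_⟩
  rw [pilotDataOfMu6K_l]
  by_cases h2 : (2 : 𝓞 K) ∈ w.asIdeal
  · have hcop : Nat.Coprime 2 l := (Nat.coprime_primes Nat.prime_two D.l_prime).mpr (by have := D.five_le_l; omega)
    exact IsCoprime.mul_dvd (Int.isCoprime_iff_gcd_eq_one.mpr (by exact_mod_cast hcop)) (h w hw h2) (l_dvd_ordq D hw)
  · exact two_mul_l_dvd_ordq_of_two_not_mem D hw h2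

/-- **Under (R2) realising q-ideles EXIST at the μ₆ carrier**, units off `S`, with the prescribed log-norms (C-cert-3's
`exists_realising_qIdeles_of_twoMulLDvdOrdq` BY NAME) — the input the pricing engines take at the carrier of record, now available at `X₆`
modulo «`ord_w(q)` even at `w ∣ 2`». [cite: Mochizuki2012, IUTchI Ex. 3.2 (iv) p. 71] [cite: DupuyHilado2025, §3.4] -/
theorem exists_realising_qIdeles_of_even_at_two (D : Mu6InitialThetaData F K Fbar E l P)
    (h : ∀ w ∈ (pilotDataOfMu6K D K).S, (2 : 𝓞 K) ∈ w.asIdeal → (2 : ℤ) ∣ (pilotDataOfMu6K D K).ordq w) :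
    ∃ tq : ∀ (pp : Nat.Primes) (x : (thetaIndex (pilotDataOfMu6K D K)).Fibre (.inr pp)),
        haveI : Fact (pp : ℕ).Prime := ⟨pp.2⟩; kOf (pilotDataOfMu6K D K) pp.1 x,
      (∀ pp x, tq pp x ≠ 0) ∧
      (∀ (pp : Nat.Primes) (x : (thetaIndex (pilotDataOfMu6K D K)).Fibre (.inr pp)),
          haveI : Fact (pp : ℕ).Prime := ⟨pp.2⟩; placeOf (pilotDataOfMu6K D K) pp.1 x ∉ (pilotDataOfMu6K D K).S → ‖tq pp x‖ = 1) ∧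
        ∀ (pp : Nat.Primes) (x : (thetaIndex (pilotDataOfMu6K D K)).Fibre (.inr pp)),
          haveI : Fact (pp : ℕ).Prime := ⟨pp.2⟩
          Real.log ‖tq pp x‖ = -((pilotDataOfMu6K D K).qPilot (placeOf (pilotDataOfMu6K D K) pp.1 x)) *
            logNorm K (placeOf (pilotDataOfMu6K D K) pp.1 x) / localDegree K (placeOf (pilotDataOfMu6K D K) pp.1 x) :=
  exists_realising_qIdeles_of_twoMulLDvdOrdq (pilotDataOfMu6K D K) ((twoMulLDvdOrdq_iff_even_at_two D).mpr h)

end SideCondition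

end Summit.ABC.IUTFork.Repair.Mu6CarrierAtTwo

end
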